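import Mathlib
import HarnessLib
import Summits.HubbardSuperconductivity.HubbardSuperconductivity.Theorems.KLProgrammeKLRegimeEngineTowerLevReadoutCloseFLinkSharpRows
import Summits.HubbardSuperconductivity.HubbardSuperconductivity.Theorems.KLProgrammeKLRegimeOverlapWtFlowAllUnif

/-!
# Route `KLProgramme` — crux K3 ENGINE (stmt-HubbardSuperconductivity-20437 `KLRegimeEngineV17F2`), stub (b) v2, THE LEVELS PACKAGE (ℓ): «(ℓ)-REKEY-ROWS»
# LINK 3 — closer‴_klEng♯-unif KEYED ON THE BASE DATUM AS ROWS (cell gate-hubbard-kl, seat gate-hubbard-kl-p3 g22, pen (R359)(A); the rows-twin of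
# p4 g21's `kernelNormsLevels_readoutF_klEng_sharp_unif` (…TowerLevReadoutCloseFLinkKlEngSharpUnif, p695357): link 2
# `kernelNormsLevels_readoutF_of_blocks_link_sharp_rows` at `K := klFlowFrameU … n` ∘ `linkDataPartialF_klEng_unif`)

WHY.  See links 1–2: the tower's base datum (`𝒱_d[K_n]` at `F_{d−1}`) enters as ROWS (`Nb ≥ 0`, `hcar`, `hlawb` at `λ = B·ε_j`, `0 < Ab`, `Ab' = Ab/B²`) plus the
binder `Z^{K_n}_{Λ_d} ≠ 0`, in place of the `(Λ_d, F_{d−1})` grid-step group; the head (`Cκ, CJ` before `d`, `Cb` after) and every other binder of p695357 — the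
per-block link data DISCHARGED from the model, the six pinned names, the (I5)-F choices, blocking, `B ≥ B₀`, imports, cell, doors, read-out constants, sharp
`Atot`, `CE` threshold, caps, six-leg cell — are byte-identical, as is the conclusion `KernelNormsLevels L M P Qe β U μ (klFlowFrameU L M β U μ n) j`.

* **`kernelNormsLevels_readoutF_klEng_sharp_unif_rows (c″)`**.
Composition of landed theorems; nothing about the model is asserted beyond them; nothing asserts (ℓ), any stub, K3 or superconductivity.
References: BGM 2006 §2.8 (2.76)–(2.84), (2.93)–(2.98), Lemma 2.5, §3 (3.2)–(3.8) [cite: BenfattoGiulianiMastropietro2006].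
-/


noncomputable section

namespace Summit.HubbardSuperconductivity.HubbardSuperconductivity.Theorems.EngineV8

set_option linter.dupNamespace false -- summit = problem name (single-conjunct summit), D-0017

open Classical
open Real Finset Literature.MathematicalPhysics.QuantumLattice Literature.Probability.LatticeModels GrassmannAlgebra
open Literature.Probability.LatticeModels.BattleFederbush
open Literature.MathematicalPhysics.QuantumLattice.FermiRG
open Summit.HubbardSuperconductivity.HubbardSuperconductivity.Theorems.KLProgrammeLegKernels
open Summit.HubbardSuperconductivity.HubbardSuperconductivity.Theorems.KLRegimeSplit
open Summit.HubbardSuperconductivity.HubbardSuperconductivity.Theorems.KLRegimeWick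
open Summit.HubbardSuperconductivity.HubbardSuperconductivity.Theorems.TorusFourierL2
open Summit.HubbardSuperconductivity.HubbardSuperconductivity.Theorems.DispersionFlow

variable {L M : ℕ} [NeZero L] [NeZero M]

set_option maxHeartbeats 400000 in -- one ~190-binder composition + the per-block data
/-- **`KernelNormsLevels` AT A READ-OUT LEVEL OF A BLOCK ON THE FLOW FRAME, LINK ROWS DISCHARGED, BASE DATUM AS ROWS — SHARP, `Cκ CJ` BEFORE `d`**
(«(ℓ)-REKEY-ROWS» link 3; rows-twin of `kernelNormsLevels_readoutF_klEng_sharp_unif`): see the module docstring.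
[cite: BenfattoGiulianiMastropietro2006, §2.8 (2.76)-(2.84), Lemma 2.5 (2.98), §3 (3.2)-(3.8)] -/
theorem kernelNormsLevels_readoutF_klEng_sharp_unif_rows (c'' : ℝ) (hc'' : 0 < c'') :
    ∃ C₁ C₂ C₁' C₂' Cinc Dinc : ℝ, 0 < C₁ ∧ 0 < C₂ ∧ 0 < C₁' ∧ 0 < C₂' ∧ 0 < Cinc ∧ 1 ≤ Dinc ∧
    ∀ R : RenConsts, R.WF2 → ∃ c₃' : ℝ, 0 < c₃' ∧ ∃ U₀' : ℝ, 0 < U₀' ∧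
      ∃ Cκ CJ : ℝ, 0 < Cκ ∧ 0 < CJ ∧ ∀ d : ℕ, ∃ Cb : ℝ, 0 < Cb ∧
      ∀ (G : GeoConsts) (P : SplitConsts) (Qh : EngConsts) (c : ℝ), P.WF → 0 < c → c ≤ klEngC₃6 P R → c ≤ c₃' →
      ∀ μ ∈ klWindowC, ∀ U : ℝ, 0 < U → U ≤ klEngU₀9 P R c → U ≤ U₀' → c'' * U ≤ 1 → ∀ β : ℝ, klBetaMin ≤ β → β ≤ Real.exp (c / U ^ 2) →
      ∀ (L M : ℕ) [NeZero L] [NeZero M], klEngL₃ β U ≤ L → klEngM₃ β U L ≤ M →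
      ∀ n : ℕ, 1 ≤ n → n ≤ nScales β + 1 → IsKLRegime U c (-(n : ℤ)) →
        HistP klPredsV17F2 L M G P Qh R β U μ 0 n → FrameOK R U (nScales β) μ (klFlowFrameU L M β U μ n) →
        (∀ m, 1 ≤ m → m < n → FlowPieceOscAt L M c'' β U μ m) →
      2 ≤ d → ∀ Kb D : ℕ, d * Kb ≤ n → 3 ≤ D →
      ∀ (cc : ℝ) (n' j : ℕ), IsKLRegime U cc (-(n' : ℤ)) → j ≤ n' →
      -- the read-out level `j` inside the block `Kb ≥ 1` («(ℓ)-READOUT-F»)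
      1 ≤ Kb → d * Kb ≤ j → j ≤ d * (Kb + 1) → j ≤ nScales β + 1 →
      ∀ (B Ab Qb ι₂ X : ℝ), 1 ≤ B → 0 < Ab → 0 ≤ Qb → 0 ≤ ι₂ → 0 ≤ X →
      -- the B-discounted data (equational binders)
      ∀ (Ab' ι₂' X' : ℝ), Ab' = Ab / B ^ 2 → ι₂' = ι₂ / B → X' = X / B ^ 2 →
      -- the BASE DATUM AS ROWS: `𝒱_d[K_n]` at `F_{d−1}` and its unit law in the discounted shape, at `λ = B·ε_j` (NO grid step)
      ∀ Nb : Fin 5 → ℕ → ℝ, (∀ t p, 0 ≤ Nb t p) →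
        (∀ (t : Fin 5) (p : ℕ) (Ωe' : Fin (2 * p) → Option (SectorLeg (sectorCount (d - 1)))), levelCount Ωe' = (t : ℕ) + 1 →
          klLevNormOf L M β μ (klFlowFrameU L M β U μ n) (d - 1) (2 * p) (klTowerInput L M β U μ (klFlowFrameU L M β U μ n) d 1) Ωe' ≤ Nb t p) →
        (∀ (t : Fin 5) (p : ℕ), 3 ≤ p → Nb t p / klLevUnitF β M t p (d - 1) ≤ Ab' * (B * epsCoupling P U j) ^ (p - 1) * Qb ^ p) →
      -- the partition function at the tower's base `Λ_d` on the flow frame (a binder)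
      hubbardEffPartitionFnCT L M β U μ 0 (klFlowFrameU L M β U μ n) (klScale klE0 d) ≠ 0 →
      -- the floor LINK data DISCHARGED on the flow frame (`linkDataPartialF_klEng_unif`): the four k-free constants pinned, the degree cap kept
      ∀ (κb αb crb ccb : ℝ), κb = Real.sqrt (2 * Cκ * klE0) → αb = Cb * ((M : ℝ) / β) * (4 : ℝ) ^ d / klE0 →
        crb = 81 * CJ * M / β → ccb = 162 * CJ * M / β →
      (∀ k, 1 ≤ k → k < Kb → Fintype.card (SpaceTimeIdx L M × SectorLeg (sectorCount (d * k - 1))) / 2 ≤ D) →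
      -- the law's six names PINNED by the link (equational binders), and the import `ι₁`
      ∀ (W Z σ Φ ψ τ ι₁ : ℝ), W = 64 * (27 : ℝ) ^ 4 * exp 2 * crb / ccb → Z = exp 4 * ccb ^ 2 * imagTimeWeight β M ^ 2 / 8 →
        σ = κb ^ 2 / (exp 4 * ccb ^ 2) → Φ = 9 * αb * ccb / ((27 : ℝ) ^ 5 * exp 1 * κb ^ 2 * crb) → ψ = exp 4 * ccb ^ 2 / κb ^ 2 →
        τ = exp 2 * κb ^ 2 / ccb ^ 2 → 0 ≤ ι₁ →
      ∀ (ρk Q' Q κA Yb Y A A' ι₃ : ℝ), ρk = max 4 (2 * τ * ψ) → Q' = Z * Qb + 1 → Q = ρk * Q' →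
        κA = W * ((27 : ℝ) ^ 5 * (C₁ / C₂) * (8 : ℝ) ^ (d - 1)) →
        Yb = ι₂ / (2 * Q') + W * Z ^ 3 * X / (4 * Q' ^ 2) + (W * (27 : ℝ) ^ 5 * Ab + κA * Ab) * Q' / 2 →
        Y = ι₂' / (2 * Q') + W * Z ^ 3 * X' / (4 * Q' ^ 2) + (W * (27 : ℝ) ^ 5 * Ab' + κA * Ab') * Q' / 2 →
        A = 2 * Y * (1 - ((2 : ℝ) ^ d)⁻¹) / (κA * Q') →
        A' = (W * (27 : ℝ) ^ 5 * Ab' + κA * Ab') + 2 * Y / Q' → ι₃ = W * Z ^ 3 * X' + A' * Q' ^ 3 →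
      max 1 Z * C₂ ^ 2 * max 4 (2 * τ * ψ) ≤ (2 : ℝ) ^ (d - 1) →
      max 1 (max (8 * Φ * τ * Yb) (128 * exp 1 * ψ ^ 3 * τ ^ 4 * Φ * κA * Yb / ((1 - ((2 : ℝ) ^ d)⁻¹) * ρk ^ 3))) ≤ B →
      (∀ k, 1 ≤ k → k ≤ Kb → W * Z ^ 1 * klTowerMuLevF L M β U μ (klFlowFrameU L M β U μ n) d k 1 ≤ ι₁ * (B * epsCoupling P U j)) →
      (∀ k, 1 ≤ k → k ≤ Kb → W * Z ^ 2 * klTowerMuLevF L M β U μ (klFlowFrameU L M β U μ n) d k 2 ≤ ι₂' * (B * epsCoupling P U j)) →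
      (∀ k, 2 ≤ k → k ≤ Kb → klTowerMuLevAtF L M β U μ (klFlowFrameU L M β U μ n) d 0 k 3 ≤ X' * (B * epsCoupling P U j) ^ 2) →
      U ≤ min 1 (min (1 / (8 * σ * Q' + 1)) (min (1 / (2 * exp 1 * τ * Q' + 1)) (min (1 / (4 * Φ * τ * ι₁ + 1))
        (min (1 / (2 * (Φ * (exp 1 * τ * ι₁ + (exp 1 * τ) ^ 2 * ι₂' + (exp 1 * τ) ^ 3 * ι₃ + A' * (exp 1 * τ * Q') ^ 2 / 2)) + 1))
          (min (A * Q ^ 3 / (16 * σ * Q' * A' * (4 * Q') ^ 3 + A * Q ^ 3))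
            (A * Q ^ 3 / (16 * exp 1 * ψ * (2 * τ * ψ * Q') ^ 2 * Φ * τ ^ 2 * ι₁ ^ 2 + A * Q ^ 3))))))) / (2 * B * P.Klam + 1) →
      cc ≤ min 1 (min (1 / (8 * σ * Q' + 1)) (min (1 / (2 * exp 1 * τ * Q' + 1)) (min (1 / (4 * Φ * τ * ι₁ + 1))
        (min (1 / (2 * (Φ * (exp 1 * τ * ι₁ + (exp 1 * τ) ^ 2 * ι₂' + (exp 1 * τ) ^ 3 * ι₃ + A' * (exp 1 * τ * Q') ^ 2 / 2)) + 1))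
          (min (A * Q ^ 3 / (16 * σ * Q' * A' * (4 * Q') ^ 3 + A * Q ^ 3))
            (A * Q ^ 3 / (16 * exp 1 * ψ * (2 * τ * ψ * Q') ^ 2 * Φ * τ ^ 2 * ι₁ ^ 2 + A * Q ^ 3))))))) * Real.log 4 / (2 * B * P.Klam + 1) →
      -- the read-out block's degree cap (its slice rows are DISCHARGED by `linkDataPartialF_klEng`)
      Fintype.card (SpaceTimeIdx L M × SectorLeg (sectorCount (d * Kb - 1))) / 2 ≤ D →
      -- the read-out constants (equational binders), the public constant's threshold, the degree cap, the six-leg cell at level `j`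
      ∀ (Aro Qro Qtot Atot : ℝ), Aro = (27 : ℝ) ^ 5 * (C₁' / C₂') * (Ab' + (8 : ℝ) ^ (d - 1) * (A / (1 - ((2 : ℝ) ^ d)⁻¹))) →
        Qro = C₂' ^ 2 * max Qb (((2 : ℝ) ^ (d - 1))⁻¹ * max Q Qb) → Qtot = Dinc * max 1 (max Qro (max (4 * Q') (2 * τ * ψ * Q'))) →
        Atot = Aro + Cinc * (A' * (4 * σ * (B * epsCoupling P U j) * Q' / (1 - 4 * σ * (B * epsCoupling P U j) * Q')) +
          exp 1 * (τ * (ι₁ * (B * epsCoupling P U j) + ι₂' / (2 * Q') + ι₃ / (4 * Q' ^ 2) + A' * Q' / 4)) *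
            (Φ * (τ * (ι₁ * (B * epsCoupling P U j) + ι₂' / (2 * Q') + ι₃ / (4 * Q' ^ 2) + A' * Q' / 4)) /
              (1 - Φ * (τ * (ι₁ * (B * epsCoupling P U j) + ι₂' / (2 * Q') + ι₃ / (4 * Q' ^ 2) + A' * Q' / 4)))) / (2 * τ * Q')) →
      ∀ Qe : EngConsts, Qtot * imagTimeWeight β M ^ 2 * B * max 1 (Atot / imagTimeWeight β M) ≤ Qe.CE →
      Fintype.card (HubbardFieldIdx L M) ≤ 2 * D + 1 →
      (∀ Ωe : Fin (2 * 3) → Option (SectorLeg (sectorCount j)), levelCount Ωe = 1 →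
        klAnisoLegKernelNormAt L M β U μ (klFlowFrameU L M β U μ n) klE0 j (2 * 3) Ωe ≤ Qe.CE ^ 3 * (epsCoupling P U j) ^ 2 * (2 : ℝ) ^ ((4 : ℤ) * j)) →
      KernelNormsLevels L M P Qe β U μ (klFlowFrameU L M β U μ n) j := by
  obtain ⟨C₁, C₂, C₁', C₂', Cinc, Dinc, hC₁, hC₂, hC₁', hC₂', hCinc, hDinc, h⟩ := kernelNormsLevels_readoutF_of_blocks_link_sharp_rows
  refine ⟨C₁, C₂, C₁', C₂', Cinc, Dinc, hC₁, hC₂, hC₁', hC₂', hCinc, hDinc, fun R hR2 => ?_⟩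
  obtain ⟨c₃, hc₃, U₀, hU₀, h'⟩ := h R hR2
  obtain ⟨Cκ, CJ, hCκ, hCJ, hdat⟩ := linkDataPartialF_klEng_unif R c'' hc''
  refine ⟨c₃, hc₃, U₀, hU₀, Cκ, CJ, hCκ, hCJ, fun d => ?_⟩
  obtain ⟨Cb, hCb, hdata⟩ := hdat d
  refine ⟨Cb, hCb, ?_⟩
  intro G P Qh c hP hc hc6 hc₃' μ hμ U hU hU9 hU₀' hcU β hβmin hβc L M _ _ hL3 hM3 n hn1 hnN hreg hhist hfr hosc hd Kb D hKbn hD cc n' j hreg' hj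
    hKb1 hKbj hjK hjN B Ab Qb ι₂ X hB hAb hQb hι₂ hX Ab' ι₂' X' hAb' hι₂' hX' Nb hNb0 hcar hlawb hZd
    κb αb crb ccb hκb hαb hcrb hccb hDl
    W Z σ Φ ψ τ ι₁ hW hZ hσ hΦ hψ hτ hι₁ ρk Q' Q κA Yb Y A A' ι₃ hρk hQ' hQ hκA hYb hY hA hA' hι₃ hblock hBle himp₁ himp₂ hcell hUdoor hcdoor
    hDK Aro Qro Qtot Atot hAro hQro hQtot hAtot Qe hCE hcard hsix
  have he : (0 : ℝ) < klE0 := by norm_num [klE0]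
  have hβ : 0 < β := KLRegimeSplit.pos_of_klBetaMin_le hβmin
  have hM0 : (0 : ℝ) < M := Nat.cast_pos.2 (Nat.pos_of_ne_zero (NeZero.ne M))
  have hκb0 : 0 < κb := by rw [hκb]; exact Real.sqrt_pos.2 (by positivity)
  have hαb0 : 0 < αb := by rw [hαb]; positivity
  have hcrb0 : 0 < crb := by rw [hcrb]; positivity
  have hccb0 : 0 < ccb := by rw [hccb]; positivity
  have hKbN' : d * Kb - 1 ≤ nScales β + 1 := by omega
  -- the per-block data from the model: block `k ≤ Kb`, slice `(Λ_{j′}, Λ_{dk}]` with `dk ≤ j′ ≤ d(k+1)`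
  have hD' : ∀ k, 1 ≤ k → k ≤ Kb → ∀ j', d * k ≤ j' → j' ≤ d * (k + 1) → j' ≤ nScales β + 1 →
      0 < Real.sqrt (Cκ * (klScale klE0 (d * k) / klScale klE0 (d * k - 1)) * (klE0 * ((8 : ℝ) ^ (d * k - 1))⁻¹)) ∧
      Real.sqrt (Cκ * (klScale klE0 (d * k) / klScale klE0 (d * k - 1)) * (klE0 * ((8 : ℝ) ^ (d * k - 1))⁻¹)) ^ 2 * (8 : ℝ) ^ (d * k) ≤ Real.sqrt (2 * Cκ * klE0) ^ 2 ∧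
      IsGramBoundedR ((sectorSubMatrix L M β (bgmFatMultiplier L M klE0 β (nambuXiCT L μ (klFlowFrameU L M β U μ n)) (d * k - 1))).transpose *
        hubbardCovSliceCT L M β μ 0 (klFlowFrameU L M β U μ n) (klScale klE0 j') (klScale klE0 (d * k)) *
        sectorSubMatrix L M β (bgmFatMultiplier L M klE0 β (nambuXiCT L μ (klFlowFrameU L M β U μ n)) (d * k - 1))) (Real.sqrt (Cκ * (klScale klE0 (d * k) / klScale klE0 (d * k - 1)) * (klE0 * ((8 : ℝ) ^ (d * k - 1))⁻¹))) ∧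
      (∀ X, ∑ Y, ‖((sectorSubMatrix L M β (bgmFatMultiplier L M klE0 β (nambuXiCT L μ (klFlowFrameU L M β U μ n)) (d * k - 1))).transpose *
        hubbardCovSliceCT L M β μ 0 (klFlowFrameU L M β U μ n) (klScale klE0 j') (klScale klE0 (d * k)) *
        sectorSubMatrix L M β (bgmFatMultiplier L M klE0 β (nambuXiCT L μ (klFlowFrameU L M β U μ n)) (d * k - 1))) X Y‖ ≤ Cb * ((M : ℝ) / β) / klScale klE0 j') ∧
      (∀ Y, ∑ X, ‖((sectorSubMatrix L M β (bgmFatMultiplier L M klE0 β (nambuXiCT L μ (klFlowFrameU L M β U μ n)) (d * k - 1))).transpose *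
        hubbardCovSliceCT L M β μ 0 (klFlowFrameU L M β U μ n) (klScale klE0 j') (klScale klE0 (d * k)) *
        sectorSubMatrix L M β (bgmFatMultiplier L M klE0 β (nambuXiCT L μ (klFlowFrameU L M β U μ n)) (d * k - 1))) X Y‖ ≤ Cb * ((M : ℝ) / β) / klScale klE0 j') ∧
      Cb * ((M : ℝ) / β) / klScale klE0 j' ≤ Cb * ((M : ℝ) / β) * (4 : ℝ) ^ d / klE0 * (4 : ℝ) ^ (d * k) ∧
      (∀ X'', ∑ X', ‖(sectorAnalysisMatrix L M β (klAnisoFamily L M β μ (klFlowFrameU L M β U μ n) klE0 (d * k)) *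
        sectorSubMatrix L M β (bgmFatMultiplier L M klE0 β (nambuXiCT L μ (klFlowFrameU L M β U μ n)) (d * k - 1))) X'' X'‖ ≤ 81 * CJ * M / β) ∧
      (∀ X', ∑ X'', ‖(sectorAnalysisMatrix L M β (klAnisoFamily L M β μ (klFlowFrameU L M β U μ n) klE0 (d * k)) *
        sectorSubMatrix L M β (bgmFatMultiplier L M klE0 β (nambuXiCT L μ (klFlowFrameU L M β U μ n)) (d * k - 1))) X'' X'‖ ≤ 162 * CJ * M / β) := by
    intro k hk1 hk j' hj1 hj2 hj3
    have hdk : 2 ≤ d * k := le_trans hd (Nat.le_mul_of_pos_right d hk1)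
    have hkn : d * k ≤ n := le_trans (Nat.mul_le_mul_left d hk) hKbn
    exact hdata G P Qh c hP hR2 hc hc6 μ hμ U hU hU9 hcU β hβmin hβc L M hL3 hM3 n hn1 hnN hreg hhist hfr hosc k hk1 hdk hkn j' hj1 hj2 hj3
  have hS := hD' Kb hKb1 le_rfl j hKbj hjK hjN
  -- the full blocks `k < Kb`: the slice at `j′ = d(k+1)` is the block, and `d(k+1) ≤ d·Kb ≤ j ≤ n_β + 1`
  have hB' : ∀ k, 1 ≤ k → k < Kb → d * (k + 1) ≤ nScales β + 1 := fun k _ hk => le_trans (Nat.mul_le_mul_left d hk) (le_trans hKbj hjN)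
  exact h' P c hP hc hc6 hc₃' μ hμ U hU hU9 hU₀' β hβmin hβc (klFlowFrameU L M β U μ n) hfr L M hL3 hM3 d Kb D hd hKbN' hD cc n' j hreg' hj
    hKb1 hKbj hjN B Ab Qb ι₂ X hB hAb hQb hι₂ hX Ab' ι₂' X' hAb' hι₂' hX' Nb hNb0 hcar hlawb hZd
    κb αb crb ccb hκb0 hαb0 hcrb0 hccb0
    (fun k => Real.sqrt (Cκ * (klScale klE0 (d * k) / klScale klE0 (d * k - 1)) * (klE0 * ((8 : ℝ) ^ (d * k - 1))⁻¹))) (fun k => Cb * ((M : ℝ) / β) / klScale klE0 (d * (k + 1)))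
    (fun k hk1 hk => (hD' k hk1 hk.le (d * (k + 1)) (Nat.mul_le_mul_left d (Nat.le_succ k)) le_rfl (hB' k hk1 hk)).1)
    (fun k hk1 hk => by rw [hκb]; exact (hD' k hk1 hk.le (d * (k + 1)) (Nat.mul_le_mul_left d (Nat.le_succ k)) le_rfl (hB' k hk1 hk)).2.1)
    (fun k hk1 hk => by rw [hαb]; exact (hD' k hk1 hk.le (d * (k + 1)) (Nat.mul_le_mul_left d (Nat.le_succ k)) le_rfl (hB' k hk1 hk)).2.2.2.2.2.1)
    (fun k hk1 hk => (hD' k hk1 hk.le (d * (k + 1)) (Nat.mul_le_mul_left d (Nat.le_succ k)) le_rfl (hB' k hk1 hk)).2.2.1)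
    (fun k hk1 hk => (hD' k hk1 hk.le (d * (k + 1)) (Nat.mul_le_mul_left d (Nat.le_succ k)) le_rfl (hB' k hk1 hk)).2.2.2.1)
    (fun k hk1 hk => (hD' k hk1 hk.le (d * (k + 1)) (Nat.mul_le_mul_left d (Nat.le_succ k)) le_rfl (hB' k hk1 hk)).2.2.2.2.1)
    (fun k hk1 hk => by rw [hcrb]; exact (hD' k hk1 hk.le (d * (k + 1)) (Nat.mul_le_mul_left d (Nat.le_succ k)) le_rfl (hB' k hk1 hk)).2.2.2.2.2.2.1)
    (fun k hk1 hk => by rw [hccb]; exact (hD' k hk1 hk.le (d * (k + 1)) (Nat.mul_le_mul_left d (Nat.le_succ k)) le_rfl (hB' k hk1 hk)).2.2.2.2.2.2.2)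
    hDl W Z σ Φ ψ τ ι₁ hW hZ hσ hΦ hψ hτ hι₁ ρk Q' Q κA Yb Y A A' ι₃ hρk hQ' hQ hκA hYb hY hA hA' hι₃ hblock hBle himp₁ himp₂ hcell hUdoor hcdoor
    (Real.sqrt (Cκ * (klScale klE0 (d * Kb) / klScale klE0 (d * Kb - 1)) * (klE0 * ((8 : ℝ) ^ (d * Kb - 1))⁻¹))) (Cb * ((M : ℝ) / β) / klScale klE0 j)
    hS.1 (by rw [hκb]; exact hS.2.1) (by rw [hαb]; exact hS.2.2.2.2.2.1) hS.2.2.1 hS.2.2.2.1 hS.2.2.2.2.1 (by rw [hcrb]; exact hS.2.2.2.2.2.2.1)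
    (by rw [hccb]; exact hS.2.2.2.2.2.2.2) hDK Aro Qro Qtot Atot hAro hQro hQtot hAtot Qe hCE hcard hsix

end Summit.HubbardSuperconductivity.HubbardSuperconductivity.Theorems.EngineV8

end
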